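import Summits.BirchSwinnertonDyer.Rank1Residual.ManinAdditive.NineShiftFineReduction
import Summits.BirchSwinnertonDyer.BirchSwinnertonDyer.Theorems.ManinLocalTwoThreeThreeShiftDescentEngine
import HarnessLib

/-!
# E-es-105 `ThreeShiftStepNine` HOLDS — the step `Γ₀(9N₀) → Γ₀(3N₀)` (`3 ∤ N₀`) of the nine-shift equaliser programme
# (route `ManinLocalTwoThree`, cell bsd-f2-manin; crux C3 `ManinPrimeToThreeAtNine` stmt-BirchSwinnertonDyer-22968; prover seat p3 gen 10)

es's STEP NINE (MEMO-es §37.9; typed row E-es-105 `NineShiftEqualiser.ThreeShiftStepNine` of `…/NineShiftFineReduction.lean`):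
for `3 ∤ N₀`, `K₃^grp(3N₀) = D^grp(3N₀)` implies `K₃^grp(9N₀) = D^grp(9N₀)`.  PROVED here (**`threeShiftStepNine_holds`**), elementarily,
from the descent engine `ThreeShiftDescent.descent` (sibling `…ThreeShiftDescentEngine.lean`, any `m`; here `m = N₀`): an additive
3-shift-invariant `φ : Γ₀(9N₀) → 𝔽₃` descends to `Γ₀(3N₀)` as soon as `φ(P_{2/3}) = φ(P_{1/3})`; and the NEW diamond class of conductor `9`,
`χ = χ₉ ∘ d` (`chiNine`: additive, diamond, 3-shift invariant), has `χ(P_{2/3}) − χ(P_{1/3}) = χ₉(1+6N₀) − χ₉(1+3N₀) = χ₉(1+3N₀) ≠ 0`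
exactly because `3 ∤ N₀` (`chiNine_P23_sub_P13_ne_zero`); so `φ − c·χ` descends for the right `c ∈ 𝔽₃`, is diamond by the hypothesis at
`3N₀` and `isDiamondChar_of_restrictsFrom`, and `φ = (φ − cχ) + cχ` is diamond.  (This is es's «`h ≤ 1` and `χ₉∘d` is new, so the
step is automatic», with the Bass–Serre count replaced by the engine.)  Nothing else: E-es-94♯ is NOT proved here; BSD is not proved by
this; Manin's conjecture is not proved by this; C3 stays OPEN.  Reference: cell memo HOME/MEMO-es.md §37.8–37.9
[cite: DarmonDiamondTaylor1995, Lemma 4.28 (p. 135)].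
-/

set_option autoImplicit false
set_option linter.dupNamespace false

open scoped MatrixGroups

open CongruenceSubgroup Matrix.SpecialLinearGroup
  Summit.BirchSwinnertonDyer.Rank1Residual.ManinAdditive.NineShiftEqualiser

namespace Summit.BirchSwinnertonDyer.BirchSwinnertonDyer.Theorems.ManinLocalTwoThree

namespace ThreeShiftDescent

/-! ### §1. The conductor-9 diamond character `χ₉ ∘ d` -/

/-- The additive character `χ₉ : (ℤ/9)ˣ/{±1} ≅ ℤ/3 → 𝔽₃` as a table on `ℤ/9` (`±1 ↦ 0`, `±2 ↦ 1`, `±4 ↦ 2`; junk `0` on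
non-units). [folklore] -/
def chi9 (x : ZMod 9) : ZMod 3 :=
  if x = 2 ∨ x = 7 then 1 else if x = 4 ∨ x = 5 then 2 else 0

/-- `χ₉` is a homomorphism on units (`x⁶ = 1 = y⁶`). [folklore] -/
theorem chi9_mul (x y : ZMod 9) (hx : x ^ 6 = 1) (hy : y ^ 6 = 1) : chi9 (x * y) = chi9 x + chi9 y := by
  revert x y hx hy
  decide

/-- `χ₉(1) = 0`. [folklore] -/
theorem chi9_one : chi9 1 = 0 := by decide

/-- In `ℤ/9`, `ad = 1` forces `d⁶ = 1`. [folklore] -/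
theorem pow_six_eq_one_of_mul_eq_one (a d : ZMod 9) (h : a * d = 1) : d ^ 6 = 1 := by
  revert a d h
  decide

variable {N₀ : ℕ}

/-- **The conductor-9 diamond class** `χ(γ) := χ₉(d_γ mod 9)` on `Γ₀(9N₀)`. [folklore] -/
def chiNine (N₀ : ℕ) (γ : Gamma0 (3 * (3 * N₀))) : ZMod 3 := chi9 (((γ : SL(2, ℤ)) 1 1 : ℤ) : ZMod 9)

/-- For `γ ∈ Γ₀(9N₀)`: `d_γ⁶ = 1` in `ℤ/9` and `c_γ = 0` in `ℤ/9`. [folklore] -/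
theorem entry_facts (γ : Gamma0 (3 * (3 * N₀))) :
    ((((γ : SL(2, ℤ)) 1 0 : ℤ) : ZMod 9) = 0) ∧ (((γ : SL(2, ℤ)) 1 1 : ℤ) : ZMod 9) ^ 6 = 1 := by
  have hc : (((γ : SL(2, ℤ)) 1 0 : ℤ) : ZMod 9) = 0 := by
    refine (ZMod.intCast_zmod_eq_zero_iff_dvd _ 9).mpr ?_
    exact (show ((9 : ℕ) : ℤ) ∣ ((3 * (3 * N₀) : ℕ) : ℤ) from ⟨N₀, by push_cast; ring⟩).trans
      ((ZMod.intCast_zmod_eq_zero_iff_dvd _ _).mp (Gamma0_mem.mp γ.2))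
  refine ⟨hc, pow_six_eq_one_of_mul_eq_one ((((γ : SL(2, ℤ)) 0 0 : ℤ) : ZMod 9)) _ ?_⟩
  have := congrArg (fun x : ℤ => (x : ZMod 9)) (gamma0_det_entries γ)
  push_cast at this
  rw [hc, mul_zero, sub_zero] at this
  exact this

/-- `χ₉ ∘ d` is additive on `Γ₀(9N₀)` (`d_{γδ} ≡ d_γ d_δ (mod 9)`). [folklore] -/
theorem isAddChar_chiNine : IsAddChar (chiNine N₀) := by
  intro γ δ
  unfold chiNine
  obtain ⟨hcγ, hdγ⟩ := entry_facts γ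
  obtain ⟨-, hdδ⟩ := entry_facts δ
  have e : (((γ * δ : Gamma0 (3 * (3 * N₀))) : SL(2, ℤ)) 1 1 : ℤ) =
      (γ : SL(2, ℤ)) 1 0 * (δ : SL(2, ℤ)) 0 1 + (γ : SL(2, ℤ)) 1 1 * (δ : SL(2, ℤ)) 1 1 := by
    simp [Matrix.mul_apply, Fin.sum_univ_two]
  rw [e]
  push_cast
  rw [hcγ, zero_mul, zero_add]
  exact chi9_mul _ _ hdγ hdδ

/-- `χ₉ ∘ d` is a diamond class (`d ≡ 1 (mod 9N₀)` on `Γ₁(9N₀)`). [folklore] -/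
theorem isDiamondChar_chiNine : IsDiamondChar (chiNine N₀) := by
  intro γ hγ
  obtain ⟨-, h11, -⟩ := (Gamma1_mem _ γ).mp hγ
  unfold chiNine
  have h9 : (9 : ℕ) ∣ 3 * (3 * N₀) := ⟨N₀, by ring⟩
  have : (((γ 1 1 : ℤ)) : ZMod 9) = 1 := by
    have := intCast_zmod_eq_of_dvd h9 (x := (γ 1 1 : ℤ)) (y := 1) (by push_cast; exact h11)
    push_cast at this; exact this
  show chi9 (((γ 1 1 : ℤ)) : ZMod 9) = 0
  rw [this, chi9_one]

/-- `χ₉ ∘ d` separates `P_{2/3}` from `P_{1/3}` iff `3 ∤ N₀`: `χ(P_{2/3}) − χ(P_{1/3}) ≠ 0`. [folklore] -/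
theorem chiNine_P23_sub_P13_ne_zero (h3 : ¬ 3 ∣ N₀) : chiNine N₀ (P23 N₀) - chiNine N₀ (P13 N₀) ≠ 0 := by
  unfold chiNine P23 P13
  simp only [g0Of, slOf_apply_11]
  push_cast
  have h9 : ((N₀ : ℕ) : ZMod 9) = ((N₀ % 9 : ℕ) : ZMod 9) := (ZMod.natCast_mod N₀ 9).symm
  rw [h9]
  have hlt : N₀ % 9 < 9 := Nat.mod_lt _ (by norm_num)
  have hne : N₀ % 9 ≠ 0 ∧ N₀ % 9 ≠ 3 ∧ N₀ % 9 ≠ 6 := by refine ⟨?_, ?_, ?_⟩ <;> intro h <;> exact h3 (by omega)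
  obtain ⟨h0, h3', h6⟩ := hne
  interval_cases (N₀ % 9) <;> first | exact absurd rfl h0 | exact absurd rfl h3' | exact absurd rfl h6 | decide

end ThreeShiftDescent

open ThreeShiftDescent in
/-- **E-es-105 `ThreeShiftStepNine` HOLDS**: for `3 ∤ N₀`, `K₃^grp(3N₀) = D^grp(3N₀) ⟹ K₃^grp(9N₀) = D^grp(9N₀)`.  For an additive
3-shift-invariant `φ` on `Γ₀(9N₀)` put `c := (φ(P_{2/3}) − φ(P_{1/3}))/(χ(P_{2/3}) − χ(P_{1/3}))` (`χ = χ₉∘d`); `φ − cχ` satisfies the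
descent condition of `ThreeShiftDescent.descent`, hence is the restriction of a 3-shift-invariant additive `w` on `Γ₀(3N₀)`, diamond by
hypothesis; so `φ − cχ`, `χ` and `φ` are diamond. [folklore] -/
theorem threeShiftStepNine_holds : ThreeShiftStepNine := by
  intro N₀ hN₀ h3 hbase
  rw [show 9 * N₀ = 3 * (3 * N₀) by ring]
  intro φ hadd hinv3
  set χ := chiNine N₀ with hχ
  set c : ZMod 3 := (φ (P23 N₀) - φ (P13 N₀)) * (χ (P23 N₀) - χ (P13 N₀))⁻¹ with hc
  set φ' : Gamma0 (3 * (3 * N₀)) → ZMod 3 := fun g => φ g - c * χ g with hφ'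
  have hχadd : IsAddChar χ := isAddChar_chiNine
  have hχD : IsDiamondChar χ := isDiamondChar_chiNine
  have hχinv : IsThreeShiftInvariant χ := isThreeShiftInvariant_of_isDiamondChar χ hχadd hχD
  have hadd' : IsAddChar φ' := by
    intro g h
    simp only [hφ', hadd g h, hχadd g h]
    ring
  have hinv' : ∀ (a b c₀ d : ℤ) (h : a * d - b * (3 * c₀) = 1) (hc : ((3 * (3 * N₀) : ℕ) : ℤ) ∣ c₀),
      φ' (g0Of a (3 * b) c₀ d (by linear_combination h) hc) = 1 * φ' (g0Of a b (3 * c₀) d h (Dvd.dvd.mul_left hc 3)) := by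
    intro a b c₀ d h hc
    simp only [hφ', hinv3 a b c₀ d h hc, hχinv a b c₀ d h hc, one_mul]
  have hP : φ' (P23 N₀) = φ' (P13 N₀) := by
    have hne := chiNine_P23_sub_P13_ne_zero h3
    simp only [hφ', hc]
    rw [sub_eq_sub_iff_sub_eq_sub, ← mul_sub, mul_assoc, inv_mul_cancel₀ hne, mul_one]
  obtain ⟨w, hwadd, hwε, hres⟩ := descent φ' 1 hadd' hinv' hP
  have hwinv : IsThreeShiftInvariant w := fun a b c₀ d h hc => by rw [hwε a b c₀ d h hc, one_mul]
  have hwD : IsDiamondChar w := hbase w hwadd hwinv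
  have hφ'D : IsDiamondChar φ' := isDiamondChar_of_restrictsFrom ⟨3, by ring⟩ hres hwD
  intro γ hγ
  have h1 := hφ'D γ hγ
  have h2 := hχD γ hγ
  simp only [hφ'] at h1
  rw [h2, mul_zero, sub_zero] at h1
  exact h1

end Summit.BirchSwinnertonDyer.BirchSwinnertonDyer.Theorems.ManinLocalTwoThree
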